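import Summits.NavierStokesRegularity.FunctionalMining.QuadraticBudgetStatic
import Summits.NavierStokesRegularity.FunctionalMining.ThreeWaveWitness
import Literature.Analysis.FluidPDE.TorusClassicalHnBalance
import HarnessLib

/-!
# Functional mining: the palinstrophy `½‖Δu‖₂²` — initial rates, parity sieve, three-wave no-go

Search for candidate a priori estimates; no regularity claim.

Cell `pub-nsfunc` (host summit NavierStokesRegularity, topic `FunctionalMining`), NO-GO branch,
dictionary family D7: the PALINSTROPHY `𝒫(u) = ½‖Δu‖₂²` (`= ½‖∇ω‖₂²` for divergence-free `u` on
`T³`; Navier–Stokes degree `3`). Written out as `2⁻¹ * ∫‖Δu‖²` throughout (no new definition).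
Along classical solutions of unforced Navier–Stokes on `T³` the tree's even-order balance
(`Torus.IsClassicalNSSolutionOn.hasDerivWithinAt_half_integral_norm_sq_laplacian_iterate`, `n = 1`;
Foias–Manley–Rosa–Temam 2001, Ch. II App. A) reads
`d/dt ½‖Δu‖₂² = −ν‖∇Δu‖₂² − ∫⟪(u·∇)u, Δ²u⟫`, i.e. in the vocabulary of `RateBudgets.lean`:

* `palinstrophy_hasInitialRate` — inertial rate `N(v) = −∫⟪(v·∇)v, Δ²v⟫`, viscous rate
  `V(v) = −‖∇Δv‖₂²`;
* `palinstrophyProduction_neg`, `palinstrophyProduction_const_smul`,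
  `gradNormSq_laplacian_const_smul`, `palinstrophy_const_smul` — parity and homogeneity (degrees
  `3, 2, 2` in the amplitude);
* `palinstrophy_rate_ray_le_budget` — dynamic reduction along the amplitude ray at `ν = 1`:
  a budget `B` forces `t³ N(w) + t² V(w) ≤ B 1 (t • w)` at every smooth divergence-free zero-mean
  datum (the static form used by the Sieve-1 refutation, `PalinstrophyRefutation.lean`);
* `palinstrophyProduction_eq_zero_of_nonincreasing`, and the NO-GO
  `not_isRateBudget_palinstrophy_zero`: **the palinstrophy is not non-increasing along every
  zero-mean classical solution on `T³`** — the three-wave field `w` of `ThreeWaveWitness.lean`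
  has `∫⟪(w·∇)w, Δ²w⟫ = −192π⁵ ≠ 0` (`ThreeWaveTorus.production2_w`, Parseval against `Δ²w`,
  reusing the six convection coefficients of that file). Sieve 2 (`Sieves.lean`) predicted it; this
  is the kernel-checked census entry (class `{𝒫}`, budget `0`, witness three-wave).
-/

noncomputable section

open MeasureTheory Complex
open scoped RealInnerProductSpace

namespace Summit.NavierStokesRegularity.FunctionalMining

open Literature.Analysis Literature.Analysis.FunctionSpaces Literature.Analysis.FunctionSpaces.Torus
  Literature.Analysis.FluidPDE

variable {d : Type*} [Fintype d] [DecidableEq d]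

/-! ## Initial rates of the palinstrophy -/

/-- **The palinstrophy has initial rates** `N(v) = −∫⟪(v·∇)v, Δ²v⟫`, `V(v) = −‖∇Δv‖₂²`: the
tree's balance `d/dt ½‖Δu‖₂² = −ν‖∇Δu‖₂² − ∫⟪(u·∇)u − f, Δ²u⟫` at `t = a`, `f = 0`.
[cite: FoiasManleyRosaTemam2001, Ch. II App. A (A.55) and §7] -/
theorem palinstrophy_hasInitialRate :
    HasInitialRate (d := d) (fun v => 2⁻¹ * ∫ x, ‖Torus.laplacian v x‖ ^ 2)
      (fun v => -∫ x, ⟪Torus.convect v v x, Torus.laplacian (Torus.laplacian v) x⟫)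
      (fun v => -Torus.gradNormSq (Torus.laplacian v)) := by
  intro hd ν hν a b hab u p hsol hmean
  have h := hsol.hasDerivWithinAt_half_integral_norm_sq_laplacian_iterate hab 1
    (Set.left_mem_Icc.2 hab.le)
  have e2 : ∀ v : UnitAddTorus d → EuclideanSpace ℝ d,
      Torus.laplacian^[2 * 1] v = Torus.laplacian (Torus.laplacian v) := fun v => rfl
  simp only [Function.iterate_one, e2, Pi.zero_apply, sub_zero] at h
  refine h.congr_deriv ?_
  ring

omit [DecidableEq d] in
/-- The palinstrophy production is odd on smooth fields: `(−v·∇)(−v) = (v·∇)v`, `Δ²(−v) = −Δ²v`.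
[folklore] -/
theorem palinstrophyProduction_neg {v : UnitAddTorus d → EuclideanSpace ℝ d} (hv : IsSmooth v) :
    (-∫ x, ⟪Torus.convect (-v) (-v) x, Torus.laplacian (Torus.laplacian (-v)) x⟫) =
      -(-∫ x, ⟪Torus.convect v v x, Torus.laplacian (Torus.laplacian v) x⟫) := by
  rw [neg_neg, ← integral_neg]
  refine integral_congr_ae (ae_of_all _ fun x => ?_)
  dsimp only
  have hc : Torus.convect (-v) (-v) x = Torus.convect v v x := by
    simp only [Torus.convect, Torus.fderiv]
    have hl : Torus.liftAt (-v) x = -Torus.liftAt v x := by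
      funext w; simp [Torus.liftAt]
    rw [hl, fderiv_neg]
    simp
  have hΔ : Torus.laplacian (-v) = -Torus.laplacian v := funext fun y => Torus.laplacian_neg_apply hv y
  rw [hc, hΔ, Torus.laplacian_neg_apply hv.laplacian x, inner_neg_right, neg_neg]

omit [DecidableEq d] in
/-- `Δ(c • v) = c • Δv` as functions, for smooth `v`. [folklore] -/
theorem laplacian_const_smul_fun {v : UnitAddTorus d → EuclideanSpace ℝ d} (hv : IsSmooth v)
    (c : ℝ) : Torus.laplacian (c • v) = c • Torus.laplacian v :=
  funext fun x => Torus.laplacian_const_smul_apply hv c x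

omit [DecidableEq d] in
/-- The palinstrophy production is cubic along amplitude rays. [folklore] -/
theorem palinstrophyProduction_const_smul {v : UnitAddTorus d → EuclideanSpace ℝ d}
    (hv : IsSmooth v) (c : ℝ) :
    (-∫ x, ⟪Torus.convect (c • v) (c • v) x, Torus.laplacian (Torus.laplacian (c • v)) x⟫) =
      c ^ 3 * -∫ x, ⟪Torus.convect v v x, Torus.laplacian (Torus.laplacian v) x⟫ := by
  rw [mul_neg, ← integral_const_mul]
  congr 1
  refine integral_congr_ae (ae_of_all _ fun x => ?_)
  dsimp only
  rw [convect_const_smul_self (hv.isContDiff (by exact_mod_cast le_top)) c x,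
    laplacian_const_smul_fun hv, laplacian_const_smul_fun hv.laplacian, Pi.smul_apply,
    real_inner_smul_left, real_inner_smul_right]
  ring

/-- `‖∇(c v)‖₂² = c² ‖∇v‖₂²` for `C¹` fields. [folklore] -/
theorem gradNormSq_const_smul {v : UnitAddTorus d → EuclideanSpace ℝ d} (hv : Torus.IsContDiff 1 v)
    (c : ℝ) : Torus.gradNormSq (c • v) = c ^ 2 * Torus.gradNormSq v := by
  have h := torusEnstrophy_const_smul hv c
  unfold torusEnstrophy at h
  linarith

/-- The viscous rate of the palinstrophy is quadratic along amplitude rays: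
`‖∇Δ(c v)‖₂² = c² ‖∇Δv‖₂²`. [folklore] -/
theorem gradNormSq_laplacian_const_smul {v : UnitAddTorus d → EuclideanSpace ℝ d} (hv : IsSmooth v)
    (c : ℝ) : Torus.gradNormSq (Torus.laplacian (c • v)) = c ^ 2 * Torus.gradNormSq (Torus.laplacian v) := by
  rw [laplacian_const_smul_fun hv,
    gradNormSq_const_smul (hv.laplacian.isContDiff (by exact_mod_cast le_top)) c]

omit [DecidableEq d] in
/-- The palinstrophy is quadratic along amplitude rays. [folklore] -/
theorem palinstrophy_const_smul {v : UnitAddTorus d → EuclideanSpace ℝ d} (hv : IsSmooth v) (c : ℝ) :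
    (2⁻¹ * ∫ x, ‖Torus.laplacian (c • v) x‖ ^ 2) = c ^ 2 * (2⁻¹ * ∫ x, ‖Torus.laplacian v x‖ ^ 2) := by
  rw [laplacianNormSq_const_smul hv c]
  ring

/-- **Dynamic reduction along the amplitude ray (palinstrophy).** If `𝒫 = ½‖Δu‖₂²` obeys a rate
budget `B` along every zero-mean classical solution of unforced Navier–Stokes on `T³`, then at
every smooth divergence-free zero-mean `w` and every real `t`:
`t³ N(w) + t² V(w) ≤ B 1 (t • w)`, `N(w) = −∫⟪(w·∇)w, Δ²w⟫`, `V(w) = −‖∇Δw‖₂²`. [folklore] -/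
theorem palinstrophy_rate_ray_le_budget {B : ℝ → (UnitAddTorus d → EuclideanSpace ℝ d) → ℝ}
    (hB : IsRateBudget (d := d) (fun v => 2⁻¹ * ∫ x, ‖Torus.laplacian v x‖ ^ 2) B)
    (hd : Fintype.card d = 3) {w : UnitAddTorus d → EuclideanSpace ℝ d} (hw : IsSmooth w)
    (hdiv : IsDivFree w) (hmean : HasZeroMean w) (t : ℝ) :
    t ^ 3 * (-∫ x, ⟪Torus.convect w w x, Torus.laplacian (Torus.laplacian w) x⟫) +
        t ^ 2 * (-Torus.gradNormSq (Torus.laplacian w)) ≤ B 1 (t • w) := by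
  have hw1 : Torus.IsContDiff 1 w := hw.isContDiff (by exact_mod_cast le_top)
  have h := initialRate_le_of_isRateBudget hB palinstrophy_hasInitialRate hd one_pos
    (hw.smul t) (isDivFree_const_smul hw1 hdiv t) (hasZeroMean_const_smul hmean t)
  rw [palinstrophyProduction_const_smul hw t, gradNormSq_laplacian_const_smul hw t, one_mul] at h
  linarith

/-- **Were the palinstrophy non-increasing along every zero-mean classical solution on `T³`, its
production `∫⟪(v·∇)v, Δ²v⟫` would vanish at every smooth divergence-free zero-mean field** (the
parity sieve, dynamic form). [folklore] -/
theorem palinstrophyProduction_eq_zero_of_nonincreasing (hd : Fintype.card d = 3)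
    (h0 : IsRateBudget (d := d) (fun v => 2⁻¹ * ∫ x, ‖Torus.laplacian v x‖ ^ 2) (fun _ _ => 0))
    {u₀ : UnitAddTorus d → EuclideanSpace ℝ d} (hu₀ : IsSmooth u₀) (hdiv : IsDivFree u₀)
    (hmean : HasZeroMean u₀) :
    ∫ x, ⟪Torus.convect u₀ u₀ x, Torus.laplacian (Torus.laplacian u₀) x⟫ = 0 := by
  have h := inertialRate_eq_zero_of_nonincreasing h0 palinstrophy_hasInitialRate
    (fun v hv => palinstrophyProduction_neg hv) hd hu₀ hdiv hmean
  linarith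

/-! ## The three-wave witness: `∫⟪(w·∇)w, Δ²w⟫ = −192π⁵` -/

namespace ThreeWaveTorus

/-- `Δ²w = Re ∑ e_k (16π⁴|k|⁴ ĉ(k))`, as the Laplacian of `Δw = realTrigPoly S cΔ`. [folklore] -/
theorem laplacian_laplacian_w (x : UnitAddTorus (Fin 3)) :
    Torus.laplacian (Torus.laplacian w) x =
      realTrigPoly S (fun k => -(((4 * Real.pi ^ 2 * freqNormSq k : ℝ) : ℂ) • cΔ k)) x := by
  rw [show Torus.laplacian w = realTrigPoly S cΔ from funext laplacian_w]
  exact laplacian_realTrigPoly S cΔ x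

/-- The coefficients of `Δ²w` are conjugate-symmetric. [folklore] -/
theorem isConjSymm_cΔΔ :
    IsConjSymm (fun k => -(((4 * Real.pi ^ 2 * freqNormSq k : ℝ) : ℂ) • cΔ k)) := by
  intro k
  simp only
  rw [isConjSymm_cΔ k, freqNormSq_neg, EuclideanSpace.conjVec_neg, EuclideanSpace.conjVec_smul,
    Complex.conj_ofReal]

/-- `∫⟪(w·∇)w, Δ²w⟫` as a finite Fourier sum (Parseval against `Δ²w`). [folklore] -/
theorem production2_eq_sum :
    ∫ x, inner ℝ (Torus.convect w w x) (Torus.laplacian (Torus.laplacian w) x) =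
      ∑ k ∈ S, (inner ℂ (Torus.convectionCoeff S c c k)
        (-(((4 * Real.pi ^ 2 * freqNormSq k : ℝ) : ℂ) • cΔ k))).re := by
  simp_rw [laplacian_laplacian_w]
  rw [integral_inner_realTrigPoly_right neg_mem_S isConjSymm_cΔΔ
    ((isSmooth_w.convect isSmooth_w).memLp 2)]
  refine Finset.sum_congr rfl fun k _ => ?_
  rw [show w = realTrigPoly S c from rfl,
    Torus.mFourierCoeff_convect_realTrigPoly neg_mem_S isConjSymm_c isConjSymm_c k]

/-- **`∫⟪(w·∇)w, Δ²w⟫ = −192π⁵`** for the three-wave field (`±e₁`: `2·32π⁵`; `±(e₁+e₂)`: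
`2·(−128π⁵)`). [folklore] -/
theorem production2_w :
    ∫ x, inner ℝ (Torus.convect w w x) (Torus.laplacian (Torus.laplacian w) x) =
      -192 * Real.pi ^ 5 := by
  obtain ⟨h1, h1', h2, h2', h12, h12'⟩ := freqNormSq_table
  rw [production2_eq_sum, sum_S, convectionCoeff_e1, convectionCoeff_neg_e1, convectionCoeff_e2,
    convectionCoeff_neg_e2, convectionCoeff_e12, convectionCoeff_neg_e12]
  simp only [cΔ, c_e1, c_neg_e1, c_e2, c_neg_e2, c_e12, c_neg_e12, h1, h1', h2, h2', h12, h12']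
  simp [PiLp.inner_apply, Fin.sum_univ_three, Complex.mul_re, Complex.mul_im, -Complex.ofReal_pow]
  ring

end ThreeWaveTorus

open ThreeWaveTorus in
/-- **NO-GO (census row 𝒫 / monotone): the palinstrophy `½‖Δu‖₂²` is not non-increasing along
every zero-mean classical solution of the unforced Navier–Stokes equations on the unit 3-torus.**
By `palinstrophyProduction_eq_zero_of_nonincreasing` it would force `∫⟪(v·∇)v, Δ²v⟫ = 0` at every
smooth divergence-free zero-mean field, and the three-wave field has `−192π⁵ ≠ 0`.
Search for candidate a priori estimates; no regularity claim. [folklore] -/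
theorem not_isRateBudget_palinstrophy_zero :
    ¬ IsRateBudget (d := Fin 3) (fun v => 2⁻¹ * ∫ x, ‖Torus.laplacian v x‖ ^ 2) (fun _ _ => 0) := by
  intro h0
  have h := palinstrophyProduction_eq_zero_of_nonincreasing (Fintype.card_fin 3) h0 isSmooth_w
    isDivFree_w hasZeroMean_w
  rw [production2_w] at h
  have : (0 : ℝ) < 192 * Real.pi ^ 5 := by positivity
  linarith

end Summit.NavierStokesRegularity.FunctionalMining

end
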